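import Literature.AlgebraicGeometry.Motives.CoherentFracColon
import Literature.AlgebraicGeometry.Motives.ClosedSubvarietyOfPoint
import HarnessLib

/-!
# The rank-one piece at an associated point: the line family and its residue map
# (rank-one dévissage of coherent modules, The Stacks Project Tag 01YF, step two)

Continuing `Motives/CoherentFracColon`: `Z` is an integral locally Noetherian scheme, `𝔘` the
intersections of a finite affine cover, `L' ≤ L` coherent families of rational functions, `ζ` an
associated point of `𝓛/𝓛'` minimal in its closure, `𝔭` the ideal of `Z₁ = closure {ζ}` and
`(𝓛' :_𝓛 𝔭)` the colon family (`FracFamily.colonFam`), whose sections over the charts through `ζ`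
inject into the generic stalk modulo `𝓛'` (`mem_of_mem_colonFam_of_mem_stalkSpan`). Given a section
`x₂` of `(𝓛' :_𝓛 𝔭)` over a vertex chart `U_{a₀} ∋ ζ` with `x₂ ∉ 𝓛'_ζ`
(`exists_mem_colonFam_notMem`), this file cuts out the RANK-ONE piece:

* `FracFamily.PointRes.resHom ζ : 𝒪_{Z,ζ} →+* K(Z₁)` — restriction to the closed subvariety
  `Z₁ = closure {ζ}` with its reduced structure (`ClosedSubvariety.ofPoint`, whose generic point is
  `ζ`): the stalk map at the generic point; it is surjective with kernel `𝔪_ζ`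
  (`ker_resHom`), i.e. `K(Z₁) = κ(ζ)`, and compatible with sections (`resHom_germ`).
  `FracFamily.PointRes.res` extends it to the rational functions regular at `ζ`.
* `FracFamily.lineSpan = 𝓛'_ζ + 𝒪_{Z,ζ} x₂ ⊆ 𝓛_ζ` and the **line family**
  `FracFamily.lineFam t = {x ∈ Γ(U_t, (𝓛' :_𝓛 𝔭)) | ζ ∈ U_t → x ∈ lineSpan}` — the sections of
  the subsheaf `𝓛₁ ⊆ (𝓛' :_𝓛 𝔭)` with `𝓛₁/𝓛' ≅ (Z₁ ↪ Z)_* 𝓖₁`, `𝓖₁ ⊆ K(Z₁)` of rank one: it is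
  coherent (`isCoherent_lineFam`), lies between `L'` and `L`, equals `L'` on the charts missing `ζ`,
  and contains `x₂ ∉ L' {a₀}` (`L' < lineFam`);
* `FracFamily.lineRes` — **the residue map `lineSpan →ₗ[A] K(Z₁)`**, `λ' + f x₂ ↦ f̄`
  (`exists_sub_mul_mem` decomposes, `res_eq_of_sub_mem` shows independence of the choice: a
  difference of two coefficients kills `x₂` modulo `𝓛'_ζ`, hence is a non-unit, hence dies in
  `κ(ζ)`); its kernel on `lineFam t` (`ζ ∈ U_t`) is exactly `L' t` (`lineRes_eq_zero_iff`, using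
  the torsion-freeness lemma of the colon file), and it is multiplicative with respect to sections
  (`lineRes_algebraMap_mul`).

The `A`-module structures: `A` acts on `K(Z)` and on `K(Z₁)`; the hypotheses `hA` (scalars regular
on `Z`) and `hAc` (the two actions agree through `res`) are what the base ring `Γ(S, 𝒪_S)` of a
morphism `Z → S` satisfies. Everything is proved; no named facts. Mathlib searched (pin v4.32):
`Scheme.Hom.stalkMap_surjective` (closed immersions), `Scheme.Hom.germ_stalkMap_apply`,
`TopCat.Presheaf.germ_stalkSpecializes_apply`, `RingHom.ker_isMaximal_of_surjective`,
`IsLocalRing.eq_maximalIdeal`, `Scheme.preimage_basicOpen` (used).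

## References

* The Stacks Project, Tag 01YF (dévissage of coherent modules), Tag 01J3 (reduced induced
  closed subscheme).
* U. Görtz, T. Wedhorn, *Algebraic Geometry I: Schemes*, 2nd ed. (2020), Lemma 12.63 (PDF p. 436);
  *Algebraic Geometry II* (2023), Thm. 23.17, proof (PDF pp. 424–425). [GortzWedhorn2020]
  [GortzWedhorn2023]
-/

universe u v

open CategoryTheory AlgebraicGeometry TopologicalSpace Opposite IsLocalRing

noncomputable section

namespace Literature.AlgebraicGeometry.Motives

namespace FracFamily

open RatFn

variable {Z : Scheme.{u}}

/-! ### Restriction of germs at `ζ` to the closed subvariety `closure {ζ}` -/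

namespace PointRes

variable (ζ : Z)

/-- The closed subvariety `Z₁ = closure {ζ}` (reduced structure), an integral scheme. [folklore] -/
abbrev sub : Scheme.{u} := (ClosedSubvariety.ofPoint Z ζ).carrier

/-- Its closed immersion `Z₁ ↪ Z`. [folklore] -/
abbrev incl : sub ζ ⟶ Z := (ClosedSubvariety.ofPoint Z ζ).ι

/-- The generic point of `Z₁` maps to `ζ`. [folklore] -/
theorem incl_genericPoint : incl ζ (genericPoint (sub ζ)) = ζ :=
  ClosedSubvariety.genericPoint_ofPoint ζ

/-- `incl ζ (generic point) ⤳ ζ` (they are equal). [folklore] -/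
theorem specializes_incl_genericPoint : incl ζ (genericPoint (sub ζ)) ⤳ ζ :=
  (incl_genericPoint ζ).symm ▸ specializes_rfl

/-- Every point of `Z₁` lies over a specialisation of `ζ`. [folklore] -/
theorem specializes_incl (y : sub ζ) : ζ ⤳ incl ζ y :=
  ClosedSubvariety.specializes_ofPoint_ι ζ y

/-- **The restriction homomorphism `𝒪_{Z,ζ} → K(Z₁)`**: the stalk map of `Z₁ ↪ Z` at the generic
point of `Z₁` (after the identification `𝒪_{Z,ζ} = 𝒪_{Z, ι(ξ)}`). [folklore] -/
def resHom : Z.presheaf.stalk ζ →+* (sub ζ).functionField :=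
  (Z.presheaf.stalkSpecializes (specializes_incl_genericPoint ζ) ≫
    (incl ζ).stalkMap (genericPoint (sub ζ))).hom

/-- `resHom` unfolded. [folklore] -/
theorem resHom_apply (t : Z.presheaf.stalk ζ) :
    resHom ζ t = (incl ζ).stalkMap (genericPoint (sub ζ))
      (Z.presheaf.stalkSpecializes (specializes_incl_genericPoint ζ) t) := rfl

/-- The identification `𝒪_{Z,ζ} → 𝒪_{Z, ι(ξ)}` is bijective. [folklore] -/
theorem stalkSpecializes_bijective :
    Function.Bijective (Z.presheaf.stalkSpecializes (specializes_incl_genericPoint ζ)) := by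
  have h' : ζ ⤳ incl ζ (genericPoint (sub ζ)) := (incl_genericPoint ζ).symm ▸ specializes_rfl
  have hiso : IsIso (Z.presheaf.stalkSpecializes (specializes_incl_genericPoint ζ)) :=
    ⟨Z.presheaf.stalkSpecializes h', by simp [TopCat.Presheaf.stalkSpecializes_comp],
      by simp [TopCat.Presheaf.stalkSpecializes_comp]⟩
  exact ConcreteCategory.bijective_of_isIso _

/-- **`resHom` is surjective** (stalk maps of closed immersions are). [folklore] -/
theorem resHom_surjective : Function.Surjective (resHom ζ) :=
  ((incl ζ).stalkMap_surjective _).comp (stalkSpecializes_bijective ζ).2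

/-- **`ker resHom = 𝔪_ζ`**: a surjection of a local ring onto a field. [folklore] -/
theorem ker_resHom : RingHom.ker (resHom ζ) = maximalIdeal (Z.presheaf.stalk ζ) :=
  eq_maximalIdeal (RingHom.ker_isMaximal_of_surjective (K := (sub ζ).functionField) _
    (resHom_surjective ζ))

/-- `resHom t = 0` iff `t` is not a unit. [folklore] -/
theorem resHom_eq_zero_iff (t : Z.presheaf.stalk ζ) : resHom ζ t = 0 ↔ ¬IsUnit t := by
  rw [← RingHom.mem_ker, ker_resHom, mem_maximalIdeal, mem_nonunits_iff]

/-- The preimage of an open containing `ζ` contains the generic point of `Z₁`. [folklore] -/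
theorem genericPoint_mem_preimage {U : Z.Opens} (hζ : ζ ∈ U) :
    genericPoint (sub ζ) ∈ (incl ζ) ⁻¹ᵁ U := by
  change incl ζ (genericPoint (sub ζ)) ∈ U
  rw [incl_genericPoint]; exact hζ

/-- **Compatibility of `resHom` with sections**: for a section `b` over `U ∋ ζ`, the restriction of
its germ at `ζ` is the rational function on `Z₁` of the pulled-back section `ι^*(b)`. [folklore] -/
theorem resHom_germ {U : Z.Opens} (hζ : ζ ∈ U) (b : Γ(Z, U)) :
    resHom ζ (Z.presheaf.germ U ζ hζ b) =
      haveI : Nonempty ((incl ζ) ⁻¹ᵁ U) := ⟨⟨_, genericPoint_mem_preimage ζ hζ⟩⟩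
      algebraMap Γ(sub ζ, (incl ζ) ⁻¹ᵁ U) (sub ζ).functionField ((incl ζ).app U b) := by
  rw [resHom_apply, TopCat.Presheaf.germ_stalkSpecializes_apply, Scheme.Hom.germ_stalkMap_apply]
  rfl

variable [IsIntegral Z]

/-- **The restriction to `Z₁` of a rational function regular at `ζ`.** [folklore] -/
def res {f : Z.functionField} (hf : IsRegularAt ζ f) : (sub ζ).functionField :=
  resHom ζ hf.choose

/-- `res` of the rational function of a germ. [folklore] -/
theorem res_toFunctionField (t : Z.presheaf.stalk ζ) (hf : IsRegularAt ζ (toFunctionField ζ t)) :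
    res ζ hf = resHom ζ t := by
  unfold res
  congr 1
  exact toFunctionField_injective ζ hf.choose_spec

/-- `res` does not depend on the regularity proof and respects equal functions. [folklore] -/
theorem res_congr {f g : Z.functionField} (hf : IsRegularAt ζ f) (hg : IsRegularAt ζ g) (h : f = g) :
    res ζ hf = res ζ hg := by
  subst h; rfl

/-- `res` is additive. [folklore] -/
theorem res_add {f g : Z.functionField} (hf : IsRegularAt ζ f) (hg : IsRegularAt ζ g) :
    res ζ (hf.add hg) = res ζ hf + res ζ hg := by
  obtain ⟨s, rfl⟩ := hf
  obtain ⟨t, rfl⟩ := hg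
  have e : toFunctionField ζ s + toFunctionField ζ t = toFunctionField ζ (s + t) := (map_add _ s t).symm
  rw [res_congr ζ _ (e ▸ (⟨s + t, rfl⟩ : IsRegularAt ζ (toFunctionField ζ (s + t)))) e,
    res_toFunctionField, res_toFunctionField, res_toFunctionField, map_add]

/-- `res` is multiplicative. [folklore] -/
theorem res_mul {f g : Z.functionField} (hf : IsRegularAt ζ f) (hg : IsRegularAt ζ g) :
    res ζ (hf.mul hg) = res ζ hf * res ζ hg := by
  obtain ⟨s, rfl⟩ := hf
  obtain ⟨t, rfl⟩ := hg
  have e : toFunctionField ζ s * toFunctionField ζ t = toFunctionField ζ (s * t) := (map_mul _ s t).symm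
  rw [res_congr ζ _ (e ▸ (⟨s * t, rfl⟩ : IsRegularAt ζ (toFunctionField ζ (s * t)))) e,
    res_toFunctionField, res_toFunctionField, res_toFunctionField, map_mul]

/-- `res 0 = 0`. [folklore] -/
theorem res_zero : res ζ (isRegularAt_zero (x := ζ)) = 0 := by
  rw [res_congr ζ _ (⟨0, rfl⟩ : IsRegularAt ζ (toFunctionField ζ 0)) (map_zero _).symm,
    res_toFunctionField, map_zero]

/-- `res 1 = 1`. [folklore] -/
theorem res_one : res ζ (isRegularAt_one (x := ζ)) = 1 := by
  rw [res_congr ζ _ (⟨1, rfl⟩ : IsRegularAt ζ (toFunctionField ζ 1)) (map_one _).symm,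
    res_toFunctionField, map_one]

/-- `res (-f) = - res f`. [folklore] -/
theorem res_neg {f : Z.functionField} (hf : IsRegularAt ζ f) (hf' : IsRegularAt ζ (-f)) :
    res ζ hf' = -res ζ hf := by
  obtain ⟨s, rfl⟩ := hf
  rw [res_congr ζ hf' (⟨-s, rfl⟩ : IsRegularAt ζ (toFunctionField ζ (-s))) (map_neg _ s).symm,
    res_toFunctionField, res_toFunctionField, map_neg]

/-- **`res f = 0` iff `f` is a non-unit at `ζ`** (`ker = 𝔪_ζ`). [folklore] -/
theorem res_eq_zero_iff {f : Z.functionField} (hf : IsRegularAt ζ f) :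
    res ζ hf = 0 ↔ ¬IsUnitAt ζ f := by
  obtain ⟨s, rfl⟩ := hf
  rw [res_toFunctionField, resHom_eq_zero_iff, isUnitAt_toFunctionField_iff]

/-- **`res` of the rational function of a section over `U ∋ ζ` is the rational function on `Z₁` of
the pulled-back section.** [folklore] -/
theorem res_algebraMap {U : Z.Opens} [Nonempty U] (hζ : ζ ∈ U) (b : Γ(Z, U))
    (hb : IsRegularAt ζ (algebraMap Γ(Z, U) Z.functionField b)) :
    res ζ hb =
      haveI : Nonempty ((incl ζ) ⁻¹ᵁ U) := ⟨⟨_, genericPoint_mem_preimage ζ hζ⟩⟩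
      algebraMap Γ(sub ζ, (incl ζ) ⁻¹ᵁ U) (sub ζ).functionField ((incl ζ).app U b) := by
  have e : algebraMap Γ(Z, U) Z.functionField b = toFunctionField ζ (Z.presheaf.germ U ζ hζ b) :=
    (toFunctionField_algebraMap_stalk (⟨ζ, hζ⟩ : U) b).symm.trans (by rw [algebraMap_stalk_eq_germ])
  rw [res_congr ζ hb (e ▸ hb) e]
  rw [show res ζ (e ▸ hb : IsRegularAt ζ (toFunctionField ζ (Z.presheaf.germ U ζ hζ b))) =
    resHom ζ (Z.presheaf.germ U ζ hζ b) from res_toFunctionField ζ _ _, resHom_germ]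

/-- **Units at a point of `Z₁` come from units at its image**: if the section `b` over `U` is a unit
at `ι y`, its pull-back is a unit at `y` (`ι⁻¹ Z_b = (Z₁)_{ι^* b}`). [folklore] -/
theorem isUnitAt_pullback {U : Z.Opens} (y : sub ζ) (hy : incl ζ y ∈ U) (b : Γ(Z, U))
    (hb : IsUnitAt (incl ζ y) (haveI : Nonempty U := ⟨⟨_, hy⟩⟩; algebraMap Γ(Z, U) Z.functionField b)) :
    haveI : Nonempty ((incl ζ) ⁻¹ᵁ U) := ⟨⟨y, hy⟩⟩
    IsUnitAt y (algebraMap Γ(sub ζ, (incl ζ) ⁻¹ᵁ U) (sub ζ).functionField ((incl ζ).app U b)) := by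
  haveI : Nonempty U := ⟨⟨_, hy⟩⟩
  have h1 : incl ζ y ∈ Z.basicOpen b := (isUnitAt_ofSection_iff hy b).1 hb
  have h2 : y ∈ (sub ζ).basicOpen ((incl ζ).app U b) := by
    rw [← Scheme.preimage_basicOpen]; exact h1
  exact (isUnitAt_ofSection_iff (show y ∈ (incl ζ) ⁻¹ᵁ U from hy) _).2 h2

end PointRes

variable [IsIntegral Z]


/-! ### The line family -/

section Line

variable {A : Type v} [CommRing A] [Algebra A Z.functionField]
variable {ι : Type} {𝔘 : CoverData Z ι} {ζ : Z} {L L' : Finset ι → Submodule A Z.functionField}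
variable {a₀ : ι} {x₂ : Z.functionField}

variable (𝔘 ζ L' a₀ x₂) in
/-- **`𝓛'_ζ + 𝒪_{Z,ζ} · x₂`**: the `𝒪_{Z,ζ}`-span of `L' {a₀} ∪ {x₂}` inside `𝓛_ζ`. [folklore] -/
def lineSpan : Submodule A Z.functionField :=
  stalkSpan ζ ((L' {a₀} : Set Z.functionField) ∪ {x₂})

variable (𝔘 ζ L L' a₀ x₂) in
/-- **The line family** `t ↦ Γ(U_t, 𝓛₁)`: sections of the colon family which, on the charts through
`ζ`, lie in `𝓛'_ζ + 𝒪_{Z,ζ} x₂`. [folklore] -/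
def lineFam (t : Finset ι) : Submodule A Z.functionField where
  carrier := {x | x ∈ colonFam 𝔘 ζ L L' t ∧ (ζ ∈ 𝔘.U t → x ∈ lineSpan ζ L' a₀ x₂)}
  zero_mem' := ⟨Submodule.zero_mem _, fun _ => Submodule.zero_mem _⟩
  add_mem' := fun hx hy => ⟨Submodule.add_mem _ hx.1 hy.1, fun h => Submodule.add_mem _ (hx.2 h) (hy.2 h)⟩
  smul_mem' := fun a _ hx => ⟨Submodule.smul_mem _ a hx.1, fun h => Submodule.smul_mem _ a (hx.2 h)⟩

/-- Membership in the line family. [folklore] -/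
theorem mem_lineFam {t : Finset ι} {x : Z.functionField} :
    x ∈ lineFam 𝔘 ζ L L' a₀ x₂ t ↔
      x ∈ colonFam 𝔘 ζ L L' t ∧ (ζ ∈ 𝔘.U t → x ∈ lineSpan ζ L' a₀ x₂) := Iff.rfl

/-- `𝓛'_ζ ≤ lineSpan`. [folklore] -/
theorem stalkSpan_le_lineSpan :
    stalkSpan (A := A) ζ (L' {a₀} : Set Z.functionField) ≤ lineSpan ζ L' a₀ x₂ :=
  stalkSpan_mono ζ Set.subset_union_left

/-- `x₂ ∈ lineSpan`. [folklore] -/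
theorem mem_lineSpan_self : x₂ ∈ lineSpan (A := A) ζ L' a₀ x₂ :=
  subset_stalkSpan _ _ (Set.mem_union_right _ (Set.mem_singleton x₂))

/-- `lineSpan` is `𝒪_{Z,ζ}`-stable. [folklore] -/
theorem isRegularAt_mul_mem_lineSpan {f x : Z.functionField} (hf : IsRegularAt ζ f)
    (hx : x ∈ lineSpan (A := A) ζ L' a₀ x₂) : f * x ∈ lineSpan (A := A) ζ L' a₀ x₂ :=
  isRegularAt_mul_mem_stalkSpan hf hx

/-- `lineFam ≤ colonFam`. [folklore] -/
theorem lineFam_le_colonFam (t : Finset ι) : lineFam 𝔘 ζ L L' a₀ x₂ t ≤ colonFam 𝔘 ζ L L' t :=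
  fun _ hx => hx.1

/-- `lineFam ≤ L`. [folklore] -/
theorem lineFam_le (t : Finset ι) : lineFam 𝔘 ζ L L' a₀ x₂ t ≤ L t :=
  fun _ hx => (colonFam_le t) hx.1

/-- The line family is monotone. [folklore] -/
theorem lineFam_mono (hLm : Monotone L) (hL'm : Monotone L') : Monotone (lineFam 𝔘 ζ L L' a₀ x₂) :=
  fun _ _ hst _ hx => ⟨colonFam_mono hLm hL'm hst hx.1, fun h => hx.2 (𝔘.anti hst h)⟩

variable (hL : IsCoherent 𝔘 L) (hL' : IsCoherent 𝔘 L') (hle : ∀ t, L' t ≤ L t)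
variable (hζa : ζ ∈ 𝔘.U {a₀})
include hL' hζa

/-- On a chart `U_t ∋ ζ`, `𝓛'_ζ = 𝒪_ζ · L' t = 𝒪_ζ · L' {a₀}`. [folklore] -/
theorem stalkSpan_eq_stalkSpan_single {t : Finset ι} (ht : t.Nonempty) (hζt : ζ ∈ 𝔘.U t) :
    stalkSpan (A := A) ζ (L' t : Set Z.functionField) = stalkSpan ζ (L' {a₀} : Set Z.functionField) := by
  obtain ⟨a, ha⟩ := ht
  rw [hL'.stalkSpan_eq_single ha hζt, hL'.stalkSpan_single_eq_single (𝔘.le_single ha hζt) hζa]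

include hle in
/-- `L' ≤ lineFam`. [folklore] -/
theorem le_lineFam (t : Finset ι) : L' t ≤ lineFam 𝔘 ζ L L' a₀ x₂ t := by
  classical
  intro x hx
  refine ⟨le_colonFam hle t hx, fun hζt => stalkSpan_le_lineSpan ?_⟩
  have hζ' : ζ ∈ 𝔘.U (insert a₀ t) :=
    𝔘.mem_of_forall (Finset.insert_nonempty a₀ t) fun b hb => by
      rcases Finset.mem_insert.1 hb with rfl | hb
      · exact hζa
      · exact 𝔘.le_single hb hζt
  rw [← hL'.stalkSpan_eq_single (Finset.mem_insert_self a₀ t) hζ']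
  exact subset_stalkSpan _ _ (hL'.mono (Finset.subset_insert a₀ t) hx)

include hle in
/-- **On the charts missing `ζ` the line family is `L'`.** [folklore] -/
theorem lineFam_eq_of_notMem {t : Finset ι} (ht : t.Nonempty) (hζ : ζ ∉ 𝔘.U t) :
    lineFam 𝔘 ζ L L' a₀ x₂ t = L' t :=
  le_antisymm (fun _ hx => (colonFam_eq_of_notMem hL' hle ht hζ).le hx.1) (le_lineFam hL' hle hζa t)

omit hL' hζa in
/-- `x₂ ∈ lineFam {a₀}` as soon as `x₂` is a section of the colon family over `U_{a₀}`. [folklore] -/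
theorem mem_lineFam_self (hx₂ : x₂ ∈ colonFam 𝔘 ζ L L' {a₀}) : x₂ ∈ lineFam 𝔘 ζ L L' a₀ x₂ {a₀} :=
  ⟨hx₂, fun _ => mem_lineSpan_self⟩

omit hL' hζa in
include hL in
/-- The line family as a `Γ(U_t, 𝒪_Z)`-submodule. [folklore] -/
theorem algebraMap_mul_mem_lineFam {t : Finset ι} (ht : t.Nonempty) (b : Γ(Z, 𝔘.U t))
    {x : Z.functionField} (hx : x ∈ lineFam 𝔘 ζ L L' a₀ x₂ t) :
    algebraMap Γ(Z, 𝔘.U t) Z.functionField b * x ∈ lineFam 𝔘 ζ L L' a₀ x₂ t :=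
  ⟨algebraMap_mul_mem_colonFam hL ht b hx.1, fun hζt =>
    isRegularAt_mul_mem_lineSpan (isRegularAt_algebraMap_sections ⟨ζ, hζt⟩ b) (hx.2 hζt)⟩

include hL hle in
/-- **The line family is coherent** (`Z` locally Noetherian, scalars of `A` regular on `Z`).
[folklore] -/
theorem isCoherent_lineFam [IsLocallyNoetherian Z]
    (hA : ∀ (a : A) (y : Z), IsRegularAt y (algebraMap A Z.functionField a)) :
    IsCoherent 𝔘 (lineFam 𝔘 ζ L L' a₀ x₂) where
  mono := lineFam_mono hL.mono hL'.mono
  smul_mem _ ht b _ hx := algebraMap_mul_mem_lineFam hL ht b hx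
  fg t ht := by
    let N : Submodule Γ(Z, 𝔘.U t) Z.functionField :=
      { carrier := lineFam 𝔘 ζ L L' a₀ x₂ t
        zero_mem' := Submodule.zero_mem _
        add_mem' := fun hx hy => Submodule.add_mem _ hx hy
        smul_mem' := fun b x hx => by
          rw [Algebra.smul_def]
          exact algebraMap_mul_mem_lineFam hL ht b hx }
    obtain ⟨S, hS, hiff⟩ := hL.exists_finset_of_le hA ht N fun x hx => (lineFam_le t) hx
    exact ⟨S, hS, fun x hx => (hiff x).1 hx⟩
  stalk_le s t hs hst y hy := by
    have ht : t.Nonempty := hs.mono hst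
    have hys : y ∈ 𝔘.U s := 𝔘.anti hst hy
    have hC := isCoherent_colonFam (ζ := ζ) hL hL' hA
    have hCs : ∀ (b : Γ(Z, 𝔘.U s)) z, z ∈ colonFam 𝔘 ζ L L' s →
        algebraMap Γ(Z, 𝔘.U s) Z.functionField b * z ∈ colonFam 𝔘 ζ L L' s :=
      fun b z hz => algebraMap_mul_mem_colonFam hL hs b hz
    have hL's : ∀ (b : Γ(Z, 𝔘.U s)) z, z ∈ L' s → algebraMap Γ(Z, 𝔘.U s) Z.functionField b * z ∈ L' s :=
      fun b z hz => hL'.smul_mem hs b hz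
    have hNs : ∀ (b : Γ(Z, 𝔘.U s)) z, z ∈ lineFam 𝔘 ζ L L' a₀ x₂ s →
        algebraMap Γ(Z, 𝔘.U s) Z.functionField b * z ∈ lineFam 𝔘 ζ L L' a₀ x₂ s :=
      fun b z hz => algebraMap_mul_mem_lineFam hL hs b hz
    refine stalkSpan_le (fun x hx => ?_) fun f z hf hz => isRegularAt_mul_mem_stalkSpan hf hz
    change x ∈ lineFam 𝔘 ζ L L' a₀ x₂ t at hx
    rw [SetLike.mem_coe, mem_stalkSpan_iff_exists (𝔘.affine hs) ⟨y, hys⟩ hNs]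
    by_cases hζt : ζ ∈ 𝔘.U t
    · -- push into `colonFam s`; the line condition persists
      have hxC : x ∈ stalkSpan (A := A) y (colonFam 𝔘 ζ L L' s : Set Z.functionField) :=
        hC.stalk_le hs hst hy (subset_stalkSpan _ _ hx.1)
      obtain ⟨b, hb, hbx⟩ := (mem_stalkSpan_iff_exists (𝔘.affine hs) ⟨y, hys⟩ hCs x).1 hxC
      exact ⟨b, hb, hbx, fun hζs =>
        isRegularAt_mul_mem_lineSpan (isRegularAt_algebraMap_sections ⟨ζ, hζs⟩ b) (hx.2 hζt)⟩
    · -- off `ζ`: `x ∈ L' t`, push into `L' s ≤ lineFam s`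
      have hxL' : x ∈ L' t := (colonFam_eq_of_notMem hL' hle ht hζt).le hx.1
      have hxs : x ∈ stalkSpan (A := A) y (L' s : Set Z.functionField) :=
        hL'.stalk_le hs hst hy (subset_stalkSpan _ _ hxL')
      obtain ⟨b, hb, hbx⟩ := (mem_stalkSpan_iff_exists (𝔘.affine hs) ⟨y, hys⟩ hL's x).1 hxs
      exact ⟨b, hb, le_lineFam hL' hle hζa s hbx⟩

end Line

/-! ### The residue map on `𝓛'_ζ + 𝒪_ζ x₂` -/

section Residue

variable {A : Type v} [CommRing A] [Algebra A Z.functionField]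
variable {ι : Type} {𝔘 : CoverData Z ι} {ζ : Z} {L L' : Finset ι → Submodule A Z.functionField}
variable {a₀ : ι} {x₂ : Z.functionField}
variable [Algebra A (PointRes.sub ζ).functionField]

variable (hA : ∀ (a : A) (y : Z), IsRegularAt y (algebraMap A Z.functionField a))
variable (hζa : ζ ∈ 𝔘.U {a₀}) (hx₂ : x₂ ∈ colonFam 𝔘 ζ L L' {a₀})
  (hx₂' : x₂ ∉ stalkSpan (A := A) ζ (L' {a₀} : Set Z.functionField))

omit [Algebra A (PointRes.sub ζ).functionField] in
include hA in
/-- **Decomposition in `𝓛'_ζ + 𝒪_ζ x₂`**: every element is `λ' + f x₂` with `λ' ∈ 𝓛'_ζ` and `f`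
regular at `ζ`. [folklore] -/
theorem exists_sub_mul_mem {x : Z.functionField} (hx : x ∈ lineSpan (A := A) ζ L' a₀ x₂) :
    ∃ f : Z.functionField, IsRegularAt ζ f ∧
      x - f * x₂ ∈ stalkSpan (A := A) ζ (L' {a₀} : Set Z.functionField) := by
  induction hx using Submodule.span_induction with
  | mem w hw =>
    obtain ⟨g, z, hg, hz, rfl⟩ := hw
    rcases hz with hz | hz
    · exact ⟨0, isRegularAt_zero, by
        rw [zero_mul, sub_zero]; exact Submodule.subset_span ⟨g, z, hg, hz, rfl⟩⟩
    · rw [Set.mem_singleton_iff] at hz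
      subst hz
      exact ⟨g, hg, by rw [sub_self]; exact Submodule.zero_mem _⟩
  | zero => exact ⟨0, isRegularAt_zero, by rw [zero_mul, sub_zero]; exact Submodule.zero_mem _⟩
  | add w w' _ _ hw hw' =>
    obtain ⟨f, hf, hfw⟩ := hw
    obtain ⟨f', hf', hfw'⟩ := hw'
    refine ⟨f + f', hf.add hf', ?_⟩
    rw [show w + w' - (f + f') * x₂ = (w - f * x₂) + (w' - f' * x₂) by ring]
    exact Submodule.add_mem _ hfw hfw'
  | smul a w _ hw =>
    obtain ⟨f, hf, hfw⟩ := hw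
    refine ⟨algebraMap A Z.functionField a * f, (hA a ζ).mul hf, ?_⟩
    rw [show a • w - algebraMap A Z.functionField a * f * x₂ = a • (w - f * x₂) by
      rw [Algebra.smul_def, Algebra.smul_def]; ring]
    exact Submodule.smul_mem _ a hfw

omit [Algebra A (PointRes.sub ζ).functionField] in
include hx₂' in
/-- **A coefficient of `x₂` vanishing modulo `𝓛'_ζ` is a non-unit** (else `x₂ ∈ 𝓛'_ζ`). [folklore] -/
theorem not_isUnitAt_of_mul_mem {f : Z.functionField}
    (hf : f * x₂ ∈ stalkSpan (A := A) ζ (L' {a₀} : Set Z.functionField)) : ¬IsUnitAt ζ f := by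
  intro hu
  apply hx₂'
  rw [show x₂ = f⁻¹ * (f * x₂) by rw [← mul_assoc, inv_mul_cancel₀ hu.ne_zero, one_mul]]
  exact isRegularAt_mul_mem_stalkSpan hu.inv.isRegularAt hf

omit [Algebra A (PointRes.sub ζ).functionField] in
include hx₂' in
/-- **The residue of a coefficient is well defined.** [folklore] -/
theorem res_eq_of_sub_mem {x f f' : Z.functionField} (hf : IsRegularAt ζ f) (hf' : IsRegularAt ζ f')
    (h : x - f * x₂ ∈ stalkSpan (A := A) ζ (L' {a₀} : Set Z.functionField))
    (h' : x - f' * x₂ ∈ stalkSpan (A := A) ζ (L' {a₀} : Set Z.functionField)) :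
    PointRes.res ζ hf = PointRes.res ζ hf' := by
  have hd : (f' - f) * x₂ ∈ stalkSpan (A := A) ζ (L' {a₀} : Set Z.functionField) := by
    rw [show (f' - f) * x₂ = (x - f * x₂) - (x - f' * x₂) by ring]
    exact Submodule.sub_mem _ h h'
  have hnu := not_isUnitAt_of_mul_mem hx₂' hd
  have hreg : IsRegularAt ζ (f' - f) := by rw [sub_eq_add_neg]; exact hf'.add (neg_mem hf)
  have h0 : PointRes.res ζ hreg = 0 := (PointRes.res_eq_zero_iff ζ hreg).2 hnu
  have e : PointRes.res ζ hf' = PointRes.res ζ hreg + PointRes.res ζ hf := by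
    rw [← PointRes.res_add]
    exact PointRes.res_congr ζ _ _ (by ring)
  rw [e, h0, zero_add]

include hA in
/-- The residue of the coefficient of `x₂` (a choice; well defined by `lineRes_eq`). [folklore] -/
def lineResFun (x : lineSpan (A := A) ζ L' a₀ x₂) : (PointRes.sub ζ).functionField :=
  PointRes.res ζ (exists_sub_mul_mem hA x.2).choose_spec.1

omit [Algebra A (PointRes.sub ζ).functionField] in
include hx₂' in
/-- **`lineResFun x = f̄` for ANY decomposition `x = λ' + f x₂`.** [folklore] -/
theorem lineResFun_eq (x : lineSpan (A := A) ζ L' a₀ x₂) {f : Z.functionField} (hf : IsRegularAt ζ f)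
    (h : (x : Z.functionField) - f * x₂ ∈ stalkSpan (A := A) ζ (L' {a₀} : Set Z.functionField)) :
    lineResFun hA x = PointRes.res ζ hf :=
  res_eq_of_sub_mem hx₂' _ hf (exists_sub_mul_mem hA x.2).choose_spec.2 h

variable (hAc : ∀ a : A, PointRes.res ζ (hA a ζ) = algebraMap A (PointRes.sub ζ).functionField a)

include hx₂' hAc in
/-- **The residue map `𝓛'_ζ + 𝒪_ζ x₂ → K(Z₁)`, `λ' + f x₂ ↦ f̄`**, `A`-linear when the actions
of `A` on `K(Z)` and `K(Z₁)` agree through the residue (`hAc`). [folklore] -/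
def lineRes : lineSpan (A := A) ζ L' a₀ x₂ →ₗ[A] (PointRes.sub ζ).functionField where
  toFun := lineResFun hA
  map_add' x y := by
    obtain ⟨f, hf, hfx⟩ := exists_sub_mul_mem hA x.2
    obtain ⟨g, hg, hgy⟩ := exists_sub_mul_mem hA y.2
    have hxy : ((x + y : lineSpan (A := A) ζ L' a₀ x₂) : Z.functionField) - (f + g) * x₂ ∈
        stalkSpan (A := A) ζ (L' {a₀} : Set Z.functionField) := by
      rw [Submodule.coe_add, show (x : Z.functionField) + y - (f + g) * x₂ =
        (x - f * x₂) + (y - g * x₂) by ring]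
      exact Submodule.add_mem _ hfx hgy
    rw [lineResFun_eq hA hx₂' _ (hf.add hg) hxy, lineResFun_eq hA hx₂' x hf hfx,
      lineResFun_eq hA hx₂' y hg hgy, PointRes.res_add]
  map_smul' a x := by
    obtain ⟨f, hf, hfx⟩ := exists_sub_mul_mem hA x.2
    have hax : ((a • x : lineSpan (A := A) ζ L' a₀ x₂) : Z.functionField) -
        (algebraMap A Z.functionField a * f) * x₂ ∈
          stalkSpan (A := A) ζ (L' {a₀} : Set Z.functionField) := by
      rw [Submodule.coe_smul, show a • (x : Z.functionField) - algebraMap A Z.functionField a * f * x₂ =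
        a • ((x : Z.functionField) - f * x₂) by rw [Algebra.smul_def, Algebra.smul_def]; ring]
      exact Submodule.smul_mem _ a hfx
    rw [RingHom.id_apply, lineResFun_eq hA hx₂' _ ((hA a ζ).mul hf) hax,
      lineResFun_eq hA hx₂' x hf hfx, PointRes.res_mul ζ (hA a ζ) hf, hAc, Algebra.smul_def]

include hx₂' hAc in
/-- `lineRes` unfolded on a decomposition. [folklore] -/
theorem lineRes_eq (x : lineSpan (A := A) ζ L' a₀ x₂) {f : Z.functionField} (hf : IsRegularAt ζ f)
    (h : (x : Z.functionField) - f * x₂ ∈ stalkSpan (A := A) ζ (L' {a₀} : Set Z.functionField)) :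
    lineRes hA hx₂' hAc x = PointRes.res ζ hf :=
  lineResFun_eq hA hx₂' x hf h

include hx₂' hAc in
/-- `lineRes x₂ = 1`. [folklore] -/
theorem lineRes_self : lineRes hA hx₂' hAc ⟨x₂, mem_lineSpan_self⟩ = 1 := by
  rw [lineRes_eq hA hx₂' hAc _ isRegularAt_one (by
    change x₂ - 1 * x₂ ∈ _; rw [one_mul, sub_self]; exact Submodule.zero_mem _), PointRes.res_one]

include hx₂' hAc in
/-- `lineRes` vanishes on `𝓛'_ζ`. [folklore] -/
theorem lineRes_eq_zero_of_mem (x : lineSpan (A := A) ζ L' a₀ x₂)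
    (hx : (x : Z.functionField) ∈ stalkSpan (A := A) ζ (L' {a₀} : Set Z.functionField)) :
    lineRes hA hx₂' hAc x = 0 := by
  rw [lineRes_eq hA hx₂' hAc x isRegularAt_zero (by rw [zero_mul, sub_zero]; exact hx),
    PointRes.res_zero]

include hx₂ hx₂' hAc hζa in
/-- **If `lineRes x = 0` then `x ∈ 𝓛'_ζ`**: the coefficient is a non-unit, and `𝔪_ζ x₂ ⊆ 𝓛'_ζ`
because `x₂` is a section of the colon family. [folklore] -/
theorem mem_stalkSpan_of_lineRes_eq_zero (x : lineSpan (A := A) ζ L' a₀ x₂)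
    (h0 : lineRes hA hx₂' hAc x = 0) :
    (x : Z.functionField) ∈ stalkSpan (A := A) ζ (L' {a₀} : Set Z.functionField) := by
  obtain ⟨f, hf, hfx⟩ := exists_sub_mul_mem hA x.2
  rw [lineRes_eq hA hx₂' hAc x hf hfx, PointRes.res_eq_zero_iff] at h0
  have hfx₂ : f * x₂ ∈ stalkSpan (A := A) ζ (L' {a₀} : Set Z.functionField) :=
    mul_mem_stalkSpan_of_mem_colonFam hζa hx₂ hf h0
  have := Submodule.add_mem _ hfx hfx₂
  rwa [sub_add_cancel] at this

include hx₂' hAc in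
/-- **`lineRes` is multiplicative for sections**: `lineRes (b x) = b̄ · lineRes x` for a section
`b` over `U ∋ ζ`, `b̄` its pull-back to `Z₁`. [folklore] -/
theorem lineRes_algebraMap_mul {U : Z.Opens} [Nonempty U] (hζ : ζ ∈ U) (b : Γ(Z, U))
    (x : lineSpan (A := A) ζ L' a₀ x₂)
    (hbx : algebraMap Γ(Z, U) Z.functionField b * (x : Z.functionField) ∈ lineSpan (A := A) ζ L' a₀ x₂) :
    lineRes hA hx₂' hAc ⟨_, hbx⟩ =
      haveI : Nonempty ((PointRes.incl ζ) ⁻¹ᵁ U) := ⟨⟨_, PointRes.genericPoint_mem_preimage ζ hζ⟩⟩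
      algebraMap Γ(PointRes.sub ζ, (PointRes.incl ζ) ⁻¹ᵁ U) (PointRes.sub ζ).functionField
        ((PointRes.incl ζ).app U b) * lineRes hA hx₂' hAc x := by
  obtain ⟨f, hf, hfx⟩ := exists_sub_mul_mem hA x.2
  have hb : IsRegularAt ζ (algebraMap Γ(Z, U) Z.functionField b) :=
    isRegularAt_algebraMap_sections ⟨ζ, hζ⟩ b
  have hdec : algebraMap Γ(Z, U) Z.functionField b * (x : Z.functionField) -
      (algebraMap Γ(Z, U) Z.functionField b * f) * x₂ ∈
        stalkSpan (A := A) ζ (L' {a₀} : Set Z.functionField) := by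
    rw [show algebraMap Γ(Z, U) Z.functionField b * (x : Z.functionField) -
        algebraMap Γ(Z, U) Z.functionField b * f * x₂ =
        algebraMap Γ(Z, U) Z.functionField b * ((x : Z.functionField) - f * x₂) by ring]
    exact isRegularAt_mul_mem_stalkSpan hb hfx
  rw [lineRes_eq hA hx₂' hAc _ (hb.mul hf) hdec, lineRes_eq hA hx₂' hAc x hf hfx,
    PointRes.res_mul ζ hb hf, PointRes.res_algebraMap ζ hζ b hb]

end Residue

/-! ### The kernel of the residue map on the line family -/

section Kernel

variable {A : Type v} [CommRing A] [Algebra A Z.functionField]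
variable {ι : Type} {𝔘 : CoverData Z ι} {ζ : Z} {L L' : Finset ι → Submodule A Z.functionField}
variable {a₀ : ι} {x₂ : Z.functionField}
variable [Algebra A (PointRes.sub ζ).functionField]
variable (hL : IsCoherent 𝔘 L) (hL' : IsCoherent 𝔘 L') (hle : ∀ t, L' t ≤ L t)
variable (hA : ∀ (a : A) (y : Z), IsRegularAt y (algebraMap A Z.functionField a))
variable (hζa : ζ ∈ 𝔘.U {a₀}) (hx₂ : x₂ ∈ colonFam 𝔘 ζ L L' {a₀})
  (hx₂' : x₂ ∉ stalkSpan (A := A) ζ (L' {a₀} : Set Z.functionField))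
variable (hAc : ∀ a : A, PointRes.res ζ (hA a ζ) = algebraMap A (PointRes.sub ζ).functionField a)

omit [Algebra A (PointRes.sub ζ).functionField] in
/-- On a chart through `ζ`, `lineFam t ≤ lineSpan` (this is the defining condition). [folklore] -/
theorem lineFam_le_lineSpan {t : Finset ι} (hζt : ζ ∈ 𝔘.U t) :
    lineFam 𝔘 ζ L L' a₀ x₂ t ≤ lineSpan (A := A) ζ L' a₀ x₂ := fun _ hx => hx.2 hζt

include hL hL' hζa hx₂ in
/-- **The kernel of the residue map on `Γ(U_t, 𝓛₁)`, `ζ ∈ U_t`, is `Γ(U_t, 𝓛')`** (`ζ` a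
minimal associated point; the torsion-freeness `mem_of_mem_colonFam_of_mem_stalkSpan`). [folklore] -/
theorem lineRes_eq_zero_iff [IsLocallyNoetherian Z]
    (hmin : ∀ y : Z, IsAssPt (A := A) 𝔘 L L' y → ζ ⤳ y → y = ζ)
    {t : Finset ι} (ht : t.Nonempty) (hζt : ζ ∈ 𝔘.U t) {x : Z.functionField}
    (hx : x ∈ lineFam 𝔘 ζ L L' a₀ x₂ t) :
    lineRes hA hx₂' hAc ⟨x, hx.2 hζt⟩ = 0 ↔ x ∈ L' t := by
  constructor
  · intro h0
    have hxs := mem_stalkSpan_of_lineRes_eq_zero hA hζa hx₂ hx₂' hAc ⟨x, hx.2 hζt⟩ h0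
    change x ∈ stalkSpan (A := A) ζ (L' {a₀} : Set Z.functionField) at hxs
    rw [← stalkSpan_eq_stalkSpan_single hL' hζa ht hζt] at hxs
    exact mem_of_mem_colonFam_of_mem_stalkSpan hL hL' hmin ht hζt hx.1 hxs
  · intro hxL'
    refine lineRes_eq_zero_of_mem hA hx₂' hAc _ ?_
    change x ∈ stalkSpan (A := A) ζ (L' {a₀} : Set Z.functionField)
    rw [← stalkSpan_eq_stalkSpan_single hL' hζa ht hζt]
    exact subset_stalkSpan _ _ hxL'

include hL' hle hζa hx₂ hx₂' hAc in
/-- `x₂ ∉ L' {a₀}` (its residue is `1`), so `L' {a₀} < lineFam {a₀}`. [folklore] -/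
theorem lt_lineFam : L' {a₀} < lineFam 𝔘 ζ L L' a₀ x₂ {a₀} := by
  refine lt_of_le_of_ne (le_lineFam hL' hle hζa {a₀}) fun h => ?_
  have hx₂L' : x₂ ∈ L' {a₀} := h ▸ mem_lineFam_self hx₂
  have h1 := lineRes_self hA hx₂' hAc (ζ := ζ) (L' := L') (a₀ := a₀)
  have h0 := lineRes_eq_zero_of_mem hA hx₂' hAc ⟨x₂, mem_lineSpan_self⟩ (subset_stalkSpan _ _ hx₂L')
  rw [h0] at h1
  exact zero_ne_one h1

end Kernel


end FracFamily

end Literature.AlgebraicGeometry.Motives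

end
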